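/-
Copyright: statement-level skeleton of a published paper (lit-balaban cell, Phase-2 proof seat p10, gen 4). No proof claims
beyond what the kernel checks below.
-/
import Mathlib
import Literature.MathematicalPhysics.QuantumFieldTheory.BalabanImbrieJaffe1984to88.BIJ85SigmaClosedCube
import Literature.MathematicalPhysics.QuantumFieldTheory.BalabanImbrieJaffe1984to88.BIJ85MomentumSymbols6I

/-!
# `BalabanImbrieJaffe1984to88.BIJ85SigmaClosedCubeZero` — T. Bałaban, J. Imbrie, A. Jaffe, *Renormalization of the Higgs model:
minimizers, propagators and the stability of mean field theory*, Commun. Math. Phys. **97** (1985) 299–329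
[BalabanImbrieJaffe1985]: Sect. 7.1 pp. 322–325 — **each l-term of (7.1.14) is a nonnegative form at EVERY momentum, and the fibre
p′ = 0 of σ_k** (file 2/3 of the closed-cube completion of Theorem 7.1.1; file 1/3 `BIJ85SigmaClosedCube` has the corrected symbols
and the citation header, file 3/3 `BIJ85Thm711ClosedCube` the theorem)

statement-level skeleton of published theorems with citation tags; proofs where landed; nothing here is a claim about
the Yang–Mills mass gap

PDF held: `paper:balaban1985-cmp97-bij-higgs-minimizers` (journal page = PDF page + 298).  WHAT IS REPRODUCED: rows **C1.Thm7.1.1** /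
**C1.Prop7.1.2** of `HOME/lit-balaban-r15/ROWS-C1.md` (owner r15, referee ref-5), boundary completion — see file 1/3.
WHAT IS KERNEL-CHECKED (zero `sorry`, standard axioms):
* p. 325 *"Clearly each term in the sum over l is a nonnegative operator"* at EVERY momentum q (boundary included): the form of the
  corrected l-term is ⟨f,(l-term)(q)f⟩ = ‖(P(q) ⊗ P(q))(w(q)·f)‖², P(q) = [δ − ∂∂̄/Δ](q) a self-adjoint idempotent also at q = 0
  (`tensorInner_t1C_eq`, `tensorInner_t1C_nonneg`); hence ⟨f,τ₁(p′)f⟩ is real, ≥ 0, and ≥ ½·(any single l-term)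
  (`tensorInner_tau1C`, `half_term_le_tau1C` — (7.1.28) τ₀ ≤ τ₁ is the case l = 0);
* **the fibre p′ = 0**: a(0) = 0 because (7.1.16) carries the factor ∂^{(1)}(0) = 0, so τ₂(0) = 0 (`aC_zero`, `tau2C_zero`) —
  consistent with what (7.1.12) gives there: by [6I] (1.83)–(1.84), second line (*"Ã_μ(l) = Δ^{−1}(l)J̃_μ(l), l ≠ 0, Ã_μ(0) = a^{−1}J̃_μ(0)"*; tree
  `Balaban1983to89.B5FiberZero`), the Landau propagator is Δ(l)^{−1} on the l ≠ 0 modes of this fibre and ∂(0) = 0, so I − ∂G∂^*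
  is the curl-complement projection there and the identity on l = 0; the l = 0 term at p′ = 0 IS the identity (`qeW_zero`,
  `projSym_zero`, `t1C_zero`, `tensorInner_t1C_zero`), hence **½‖f‖² ≤ ⟨f, σ_k(0)f⟩** for every f, uniformly in k
  (`half_normSq_le_sigmaC_zero`).
* **the corrected symbols ARE [6I]'s functions at EVERY momentum**: at η = 1/n, p = p′ + 2πk (`B4Strip.shiftr`), `vC` = `Balaban1983to89.
  B5Prop11Fiber.vSym` and `uC` = `B5Prop11Fiber.uSym` unconditionally (`vC_eq_6I`, `uC_eq_6I`; gen-2's `BIJ85MomentumSymbols6I` had the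
  raw-quotient versions only off the zero set) — so [6I]'s (1.83)–(1.84) fibre matrices `B5Prop11Fiber.balabanFiber` and the present
  σ^C_k(p) live over literally the same functions.
NOT CLAIMED: the identification with the configuration-space σ_k (p27's lane).  Unit `lit-balaban-p10` (gen 4).
-/

namespace Literature.MathematicalPhysics.QuantumFieldTheory.BalabanImbrieJaffe1984to88.BIJ85SigmaClosedCubeZero

open scoped BigOperators Real ComplexConjugate Topology Matrix Kronecker
open Finset Filter Matrix
open Literature.MathematicalPhysics.QuantumFieldTheory.BalabanImbrieJaffe1984to88.BIJ85MomentumSymbols71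
open Literature.MathematicalPhysics.QuantumFieldTheory.BalabanImbrieJaffe1984to88.BIJ85CurlComplement719
open Literature.MathematicalPhysics.QuantumFieldTheory.BalabanImbrieJaffe1984to88.BIJ85Tau0Positivity729
open Literature.MathematicalPhysics.QuantumFieldTheory.BalabanImbrieJaffe1984to88.BIJ85Tau2Kernel715
open Literature.MathematicalPhysics.QuantumFieldTheory.BalabanImbrieJaffe1984to88.BIJ85SigmaOnCurls325
open Literature.MathematicalPhysics.QuantumFieldTheory.BalabanImbrieJaffe1984to88.BIJ85AveragingSums716
open Literature.MathematicalPhysics.QuantumFieldTheory.BalabanImbrieJaffe1984to88.BIJ85Prop712Fibre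
open Literature.MathematicalPhysics.QuantumFieldTheory.BalabanImbrieJaffe1984to88.BIJ85Thm711Fibrewise
open Literature.MathematicalPhysics.QuantumFieldTheory.BalabanImbrieJaffe1984to88.BIJ85Sect7Statements
open Literature.MathematicalPhysics.QuantumFieldTheory.BalabanImbrieJaffe1984to88.BIJ85SigmaClosedCube
open Literature.MathematicalPhysics.QuantumFieldTheory.BalabanImbrieJaffe1984to88.BIJ85MomentumSymbols6I
open Literature.MathematicalPhysics.QuantumFieldTheory.Balaban1983to89

noncomputable section

variable {d : ℕ}

/-! ## §4 Each l-term is a nonnegative form (also at the boundary); the fibre p′ = 0 -/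

/-- kernel: for a self-adjoint idempotent matrix M, x̄·(Mx) = |Mx|². [folklore] -/
private theorem star_dot_mulVec_of_proj {ι : Type*} [Fintype ι] [DecidableEq ι] (A : Matrix ι ι ℂ) (hA : Aᴴ = A)
    (hA2 : A * A = A) (x : ι → ℂ) :
    star x ⬝ᵥ (A *ᵥ x) = ((∑ i, ‖(A *ᵥ x) i‖ ^ 2 : ℝ) : ℂ) := by
  have h : star x ⬝ᵥ (A *ᵥ x) = star (A *ᵥ x) ⬝ᵥ (A *ᵥ x) := by
    rw [Matrix.star_mulVec, hA, ← Matrix.dotProduct_mulVec, Matrix.mulVec_mulVec, hA2]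
  rw [h]
  simp only [dotProduct, Pi.star_apply, Complex.star_def, Complex.conj_mul']
  push_cast
  rfl

/-- kernel: P ⊗ P is a self-adjoint idempotent for the bracket P = `projK e` (any e, e = 0 included). [folklore] -/
private theorem kronecker_projK (e : Fin d → ℂ) :
    (projK e ⊗ₖ projK e)ᴴ = projK e ⊗ₖ projK e ∧ (projK e ⊗ₖ projK e) * (projK e ⊗ₖ projK e) = projK e ⊗ₖ projK e := by
  constructor
  · rw [Matrix.conjTranspose_kronecker, projK_conjTranspose]
  · rw [← Matrix.mul_kronecker_mul, projK_mul_projK]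

/-- **p. 325 «Clearly each term in the sum over l is a nonnegative operator», on the closed cube**: the form of the corrected
l-term at ANY momentum q is ⟨f, (l-term)(q) f⟩ = ‖(P(q) ⊗ P(q))g‖², g = (u/(vv))(q)·f, P(q) = [δ − ∂∂̄/Δ](q) (at q = 0: P = 1).
[cite: BalabanImbrieJaffe1985, (7.1.28) p.325] -/
theorem tensorInner_t1C_eq (n : ℕ) (q : Fin d → ℝ) (f : Fin d → Fin d → ℂ) :
    tensorInner f (t1C n q) f =
      ((∑ i : Fin d × Fin d,
        ‖((projK (dSym ((n : ℝ)⁻¹) q) ⊗ₖ projK (dSym ((n : ℝ)⁻¹) q)) *ᵥ fun i : Fin d × Fin d => gW n q f i.1 i.2) i‖ ^ 2 : ℝ) : ℂ) := by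
  set e := dSym ((n : ℝ)⁻¹) q
  have h1 : tensorInner f (t1C n q) f =
      ∑ μ, ∑ ν, conj (gW n q f μ ν) * ∑ l, ∑ κ, projK e μ l * projK e ν κ * gW n q f l κ := by
    unfold tensorInner t1C gW
    simp only [Finset.mul_sum, map_mul, projSym_eq_projK]
    exact Finset.sum_congr rfl fun μ _ => Finset.sum_congr rfl fun ν _ => Finset.sum_congr rfl fun l _ =>
      Finset.sum_congr rfl fun κ _ => by ring
  have h2 : ∑ μ, ∑ ν, conj (gW n q f μ ν) * ∑ l, ∑ κ, projK e μ l * projK e ν κ * gW n q f l κ =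
      star (fun i : Fin d × Fin d => gW n q f i.1 i.2) ⬝ᵥ
        ((projK e ⊗ₖ projK e) *ᵥ fun i : Fin d × Fin d => gW n q f i.1 i.2) := by
    rw [dotProduct, Fintype.sum_prod_type]
    refine Finset.sum_congr rfl fun μ _ => Finset.sum_congr rfl fun ν _ => ?_
    rw [Pi.star_apply, Complex.star_def, Matrix.mulVec, dotProduct, Fintype.sum_prod_type]
    simp only [Matrix.kroneckerMap_apply]
  rw [h1, h2, star_dot_mulVec_of_proj _ (kronecker_projK e).1 (kronecker_projK e).2]

/-- Hence 0 ≤ ⟨f, (l-term)(q) f⟩ ∈ ℝ at every momentum q of every shift (boundary included).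
[cite: BalabanImbrieJaffe1985, (7.1.28) p.325] -/
theorem tensorInner_t1C_nonneg (n : ℕ) (q : Fin d → ℝ) (f : Fin d → Fin d → ℂ) :
    0 ≤ (tensorInner f (t1C n q) f).re ∧ (tensorInner f (t1C n q) f).im = 0 := by
  rw [tensorInner_t1C_eq, Complex.ofReal_re, Complex.ofReal_im]
  exact ⟨by positivity, rfl⟩

/-- kernel: `tensorInner` is additive in the kernel over a finite sum. [folklore] -/
private theorem tensorInner_sum {ι : Type*} (s : Finset ι) (K : ι → Fin d → Fin d → Fin d → Fin d → ℂ)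
    (f : Fin d → Fin d → ℂ) :
    tensorInner f (fun μ ν l κ => ∑ i ∈ s, K i μ ν l κ) f = ∑ i ∈ s, tensorInner f (K i) f := by
  classical
  induction s using Finset.induction_on with
  | empty => simp [tensorInner]
  | @insert a s ha ih =>
    unfold tensorInner at ih ⊢
    simp only [Finset.sum_insert ha, mul_add, add_mul, Finset.sum_add_distrib, ih]

/-- kernel: `tensorInner` is homogeneous in the kernel. [folklore] -/
private theorem tensorInner_const_mul (c : ℂ) (K : Fin d → Fin d → Fin d → Fin d → ℂ) (f : Fin d → Fin d → ℂ) :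
    tensorInner f (fun μ ν l κ => c * K μ ν l κ) f = c * tensorInner f K f := by
  unfold tensorInner
  simp only [Finset.mul_sum]
  exact Finset.sum_congr rfl fun μ _ => Finset.sum_congr rfl fun ν _ => Finset.sum_congr rfl fun l _ =>
    Finset.sum_congr rfl fun κ _ => by ring

/-- ⟨f, τ₁(p′)f⟩ = ½Σ_l ⟨f, (l-term)(p′ + l) f⟩ on the closed cube. [cite: BalabanImbrieJaffe1985, (7.1.14) p.322] -/
theorem tensorInner_tau1C (n M : ℕ) (p : Fin d → ℝ) (f : Fin d → Fin d → ℂ) :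
    tensorInner f (tau1C n M p) f = (1 / 2 : ℂ) * ∑ m ∈ lShifts d M, tensorInner f (t1C n (shiftMom p m)) f := by
  rw [← tensorInner_sum, ← tensorInner_const_mul]
  rfl

/-- Hence ⟨f, τ₁(p′)f⟩ is a nonnegative real number at every p′ of the closed cube, and each single l-term is a lower bound:
½⟨f,(l-term)(p′ + l)f⟩ ≤ ⟨f,τ₁(p′)f⟩ ((7.1.28) τ₀ ≤ τ₁ is the case l = 0). [cite: BalabanImbrieJaffe1985, (7.1.28) p.325] -/
theorem half_term_le_tau1C (n M : ℕ) (p : Fin d → ℝ) (f : Fin d → Fin d → ℂ) {m : Fin d → ℤ} (hm : m ∈ lShifts d M) :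
    1 / 2 * (tensorInner f (t1C n (shiftMom p m)) f).re ≤ (tensorInner f (tau1C n M p) f).re ∧
      (tensorInner f (tau1C n M p) f).im = 0 := by
  have h12 : (1 / 2 : ℂ) = ((1 / 2 : ℝ) : ℂ) := by norm_num
  rw [tensorInner_tau1C, h12, Complex.re_ofReal_mul, Complex.im_ofReal_mul,
    Complex.re_sum (lShifts d M) (fun m => tensorInner f (t1C n (shiftMom p m)) f),
    Complex.im_sum (lShifts d M) (fun m => tensorInner f (t1C n (shiftMom p m)) f),
    ← Finset.add_sum_erase (lShifts d M) (fun m => (tensorInner f (t1C n (shiftMom p m)) f).re) hm]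
  have hnn : ∀ m' ∈ (lShifts d M).erase m, 0 ≤ (tensorInner f (t1C n (shiftMom p m')) f).re :=
    fun m' _ => (tensorInner_t1C_nonneg n _ f).1
  have h0 := Finset.sum_nonneg hnn
  refine ⟨by nlinarith, ?_⟩
  rw [Finset.sum_eq_zero fun m' _ => (tensorInner_t1C_nonneg n (shiftMom p m') f).2, mul_zero]

/-- kernel: ∂^{(1)}(0) = 0, so a(0) = 0 ((7.1.16) carries the factor ∂^{(1)}_μ(p′)). [cite: BalabanImbrieJaffe1985, (7.1.16) p.323] -/
theorem aC_zero (n M : ℕ) : aC (d := d) n M 0 = 0 := by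
  funext μ
  simp [aC, dOne]

/-- **τ₂(0) = 0**: at the fibre p′ = 0 the correction term vanishes (a(0) = 0; by [6I] (1.83)–(1.84), second line, the Landau
propagator is Δ(l)^{−1} on the l ≠ 0 modes of this fibre and ∂(0) = 0). [cite: BalabanImbrieJaffe1985, (7.1.15) p.323] -/
theorem tau2C_zero (n M : ℕ) (μ ν l κ : Fin d) : tau2C (d := d) n M 0 μ ν l κ = 0 := by
  simp [tau2C, tau2Kernel, aC_zero]

/-- kernel: ∂(0) = 0, v(0) = 1, so the Q^e-weights at q = 0 are 1. [cite: BalabanImbrieJaffe1985, (7.1.11) p.322] -/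
theorem qeW_zero {n : ℕ} (hn : 0 < n) (μ ν : Fin d) : qeW (d := d) n 0 μ ν = 1 := by
  have h0 : ∀ ρ : Fin d, dSym ((n : ℝ)⁻¹) (0 : Fin d → ℝ) ρ = 0 := fun ρ => by simp [dSym]
  rw [qeW]
  exact Finset.prod_eq_one fun ρ _ => vC_eq_one hn (h0 ρ)

/-- kernel: the bracket at q = 0 is the identity ([δ − ∂∂̄/Δ](0) = δ since ∂(0) = 0). [cite: BalabanImbrieJaffe1985, (7.1.14) p.322] -/
theorem projSym_zero (η : ℝ) (μ l : Fin d) : projSym (d := d) η 0 μ l = if μ = l then 1 else 0 := by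
  simp [projSym, dSym]

/-- **The l = 0 term at p′ = 0 is the identity**: (l-term)(0)_{μνλκ} = δ_{μλ}δ_{νκ}. [cite: BalabanImbrieJaffe1985, (7.1.28) p.325] -/
theorem t1C_zero {n : ℕ} (hn : 0 < n) (μ ν l κ : Fin d) :
    t1C (d := d) n 0 μ ν l κ = (if μ = l then 1 else 0) * (if ν = κ then 1 else 0) := by
  rw [t1C, qeW_zero hn, qeW_zero hn, projSym_zero, projSym_zero, map_one, one_mul, one_mul]

/-- … so its form is ‖f‖²: ⟨f, (l = 0 term)(0) f⟩ = Σ_{μν}|f_{μν}|². [cite: BalabanImbrieJaffe1985, (7.1.28) p.325] -/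
theorem tensorInner_t1C_zero {n : ℕ} (hn : 0 < n) (f : Fin d → Fin d → ℂ) :
    tensorInner f (t1C (d := d) n 0) f = ((normSq f : ℝ) : ℂ) := by
  unfold tensorInner normSq
  simp only [t1C_zero hn, mul_ite, mul_one, mul_zero, ite_mul, zero_mul, Finset.sum_ite_eq, Finset.mem_univ,
    if_true]
  push_cast
  refine Finset.sum_congr rfl fun μ _ => Finset.sum_congr rfl fun ν _ => ?_
  rw [← Complex.conj_mul']

/-- **Theorem 7.1.1 at the fibre p′ = 0** (the point where the printed formulas (7.1.7)–(7.1.16) are singular): for every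
two-index array f (a fortiori every two-form), ½‖f‖² ≤ ⟨f, σ_k(0)f⟩ — the l = 0 term is the identity, every other l-term is a
nonnegative projection form, τ₂(0) = 0; uniformly in k (n ≥ 1, any cut-off M). [cite: BalabanImbrieJaffe1985, Thm. 7.1.1 p.321] -/
theorem half_normSq_le_sigmaC_zero {n : ℕ} (hn : 0 < n) (M : ℕ) (f : Fin d → Fin d → ℂ) :
    1 / 2 * normSq f ≤ (tensorInner f (sigmaC (d := d) n M 0) f).re := by
  have hσ : tensorInner f (sigmaC (d := d) n M 0) f = tensorInner f (tau1C n M 0) f := by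
    unfold sigmaC
    rw [tensorInner_add_kernel]
    have : tensorInner f (tau2C (d := d) n M 0) f = 0 := by
      unfold tensorInner; exact Finset.sum_eq_zero fun μ _ => Finset.sum_eq_zero fun ν _ =>
        Finset.sum_eq_zero fun l _ => Finset.sum_eq_zero fun κ _ => by rw [tau2C_zero]; ring
    rw [this, add_zero]
  rw [hσ]
  have h := (half_term_le_tau1C n M (0 : Fin d → ℝ) f (zero_mem_lShifts d M)).1
  rw [shiftMom_zero, tensorInner_t1C_zero hn, Complex.ofReal_re] at h
  exact h


/-! ## §5 The corrected symbols are [6I]'s functions (`Balaban1983to89.B5Prop11Fiber`) at every momentum -/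

/-- **(7.1.7) = [6I] (1.61) at EVERY momentum**: at η = 1/n and p = p′ + 2πk the corrected v_μ IS `B5Prop11Fiber.vSym n k p′ μ` —
both fill the removable singularity with 1 ([6I] p. 23 *"u_k(0) = 1"*). [cite: BalabanImbrieJaffe1985, (7.1.7) p.322] -/
theorem vC_eq_6I {n : ℕ} (hn : n ≠ 0) (k : Fin d → Fin n) (s : Fin d → ℝ) (μ : Fin d) :
    vC n (B4Strip.shiftr n k s) μ = B5Prop11Fiber.vSym n k s μ := by
  have hn0 : 0 < n := Nat.pos_of_ne_zero hn
  have hη : (1 / (n : ℝ)) = ((n : ℝ))⁻¹ := one_div _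
  by_cases hd : B5Prop11Fiber.dSym n k s μ = 0
  · rw [B5Prop11Fiber.vSym, if_pos hd]
    refine vC_eq_one hn0 ?_
    rw [← hη, dSym_eq_6I hn, hd]
  · have hd' : dSym ((n : ℝ)⁻¹) (B4Strip.shiftr n k s) μ ≠ 0 := by rwa [← hη, dSym_eq_6I hn]
    rw [vC_eq_vSym hn0 hd', ← hη, vSym_eq_6I hn k s μ (by rwa [hη])]

/-- **(7.1.9) = [6I] (1.31) at EVERY momentum**: the corrected u IS `B5Prop11Fiber.uSym n k p′`. [cite: BalabanImbrieJaffe1985, (7.1.9) p.322] -/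
theorem uC_eq_6I {n : ℕ} (hn : n ≠ 0) (k : Fin d → Fin n) (s : Fin d → ℝ) :
    uC n (B4Strip.shiftr n k s) = B5Prop11Fiber.uSym n k s := by
  rw [uC, B5Prop11Fiber.uSym]
  exact Finset.prod_congr rfl fun μ _ => vC_eq_6I hn k s μ

end

end Literature.MathematicalPhysics.QuantumFieldTheory.BalabanImbrieJaffe1984to88.BIJ85SigmaClosedCubeZero
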